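import Summits.SmoothPoincare4.SmoothPoincare4.Theorems.EntropyRungNoncompactShrinkerGapHeatWeightedGreen

/-!
# Fixed-time dissipation of the cut-off Fisher information on a complete weighted manifold
# (crux `EntropyRung.NoncompactShrinkerGap`, stmt-SmoothPoincare4-10868, line `collapsed-ends-usc`, v13)

Non-compact counterpart of `integral_derivWithin_fisher_le` (`BakryEmeryHeatFlow.lean`): for `(M, g)` modelled on
`ℝⁿ` (NOT compact), `Ric + Hess V ≥ K g`, `L = Δ − g⁻¹(dV, d·)`, `φ` smooth on `M × S` with `∂ₜφ = Lφ − |∇φ|²`, and a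
smooth COMPACTLY SUPPORTED `η ≥ 0`: `∫ η ∂ₜ(|∇φ|² e^{-φ} e^{-V}) ≤ −2K ∫ η |∇φ|² e^{-φ}e^{-V} + ∫ |∇φ|² e^{-φ} (Lη) e^{-V}`
(`fisherCutoff_le`, registered as `helper_fisherCutoff`). Proof: `fisher_pointwise_le` times `η`, integrated; the
`L`- and gradient terms are integrated by parts with the weighted Green identities with one compactly supported
factor (`weightedGreen_left/right`); everything cancels except `−2K ∫ η|∇φ|²e^{-φ}e^{-V}` and the boundary term
carried by `Lη`. Everything is proved; no definitions. Source: Carrillo–Ni 2009, §3 (p. 8); Bakry–Émery 1985.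
-/

noncomputable section

set_option linter.dupNamespace false

open scoped Manifold ContDiff ENNReal NNReal Topology
open MeasureTheory Set Filter
open Literature.Geometry.Lorentzian Literature.Geometry.Riemannian

namespace Summit.SmoothPoincare4.SmoothPoincare4.Theorems.NoncompactShrinkerGapHeat

section Fisher

variable {n : ℕ} {M : Type*} [TopologicalSpace M] [T2Space M] [SecondCountableTopology M]
  [ChartedSpace (EuclideanSpace ℝ (Fin n)) M] [IsManifold (𝓡 n) ∞ M] [T3Space M] [MeasurableSpace M]
  [BorelSpace M]
  {g : PseudoRiemannianMetric (𝓡 n) ∞ (EuclideanSpace ℝ (Fin n)) (TangentSpace (𝓡 n) : M → Type _)}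
  [g.HasLeviCivita]

omit [T2Space M] [SecondCountableTopology M] [T3Space M] [MeasurableSpace M] [BorelSpace M] [g.HasLeviCivita] in
/-- `g⁻¹(d(ab), β) = a g⁻¹(db, β) + b g⁻¹(da, β)` (Leibniz rule inside the inverse metric). [folklore] -/
theorem innerDual_mvfderiv_mul_left {a b : M → ℝ} {x : M} (ha : MDifferentiableAt (𝓡 n) 𝓘(ℝ, ℝ) a x)
    (hb : MDifferentiableAt (𝓡 n) 𝓘(ℝ, ℝ) b x) (β : Module.Dual ℝ (TangentSpace (𝓡 n) x)) :
    g.innerDual x (mvfderiv (𝓡 n) (fun y ↦ a y * b y) x).toLinearMap β =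
      a x * g.innerDual x (mvfderiv (𝓡 n) b x).toLinearMap β
        + b x * g.innerDual x (mvfderiv (𝓡 n) a x).toLinearMap β := by
  rw [mvfderiv_fun_mul ha hb]
  simp only [ContinuousLinearMap.toLinearMap_add, ContinuousLinearMap.toLinearMap_smul, g.innerDual_add_left,
    g.innerDual_smul_left]

omit [T2Space M] [SecondCountableTopology M] [T3Space M] [MeasurableSpace M] [BorelSpace M] [g.HasLeviCivita] in
/-- `g⁻¹(d(e^{-F}), β) = −e^{-F} g⁻¹(dF, β)`. [folklore] -/
theorem innerDual_mvfderiv_exp_neg_left {F : M → ℝ} {x : M} (hF : MDifferentiableAt (𝓡 n) 𝓘(ℝ, ℝ) F x)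
    (β : Module.Dual ℝ (TangentSpace (𝓡 n) x)) :
    g.innerDual x (mvfderiv (𝓡 n) (fun y ↦ Real.exp (-F y)) x).toLinearMap β =
      -Real.exp (-F x) * g.innerDual x (mvfderiv (𝓡 n) F x).toLinearMap β := by
  rw [show (mvfderiv (𝓡 n) (fun y ↦ Real.exp (-F y)) x).toLinearMap =
      (mvfderiv (𝓡 n) (fun y ↦ Real.exp (-F y)) x : TangentSpace (𝓡 n) x →ₗ[ℝ] ℝ) from rfl,
    mvfderiv_exp_neg_toLinearMap (I := 𝓡 n) hF, g.innerDual_smul_left]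

/-- **Dissipation of the cut-off Fisher information at a fixed time** on a (non-compact) Riemannian manifold
modelled on `ℝⁿ` with `Ric + Hess V ≥ K g`: for `φ` smooth on `M × S` with `∂ₜφ = Lφ − |∇φ|²` and a smooth compactly
supported `η ≥ 0`, at `t ∈ S`,
`∫ η ∂ₜ(|∇φ|² e^{-φ} e^{-V}) ≤ −2K ∫ η |∇φ|² e^{-φ} e^{-V} + ∫ |∇φ|² e^{-φ} (Lη) e^{-V}`.
[cite: CarrilloNi2009, §3 (p. 8)] -/
theorem fisherCutoff_le (hg : g.IsRiemannian) {V : M → ℝ} {K : ℝ}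
    (hV : ContMDiff (𝓡 n) 𝓘(ℝ, ℝ) ∞ V)
    (hRic : ∀ (y : M) (X : TangentSpace (𝓡 n) y), K * g.val y X X ≤ g.ricci y X X + g.hessian V y X X)
    {φ : ℝ → M → ℝ} {S : Set ℝ} (hS : UniqueDiffOn ℝ S) (hS' : S ⊆ closure (interior S))
    (hφ : ContMDiffOn ((𝓡 n).prod 𝓘(ℝ, ℝ)) 𝓘(ℝ, ℝ) ∞ (fun p : M × ℝ ↦ φ p.2 p.1) (univ ×ˢ S))
    (heq : ∀ t ∈ S, ∀ y : M, derivWithin (fun s ↦ φ s y) S t =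
      g.dalembertian (φ t) y
        - g.innerDual y (mvfderiv (𝓡 n) V y).toLinearMap (mvfderiv (𝓡 n) (φ t) y).toLinearMap
        - g.gradSq (φ t) y)
    {η : M → ℝ} (hη : ContMDiff (𝓡 n) 𝓘(ℝ, ℝ) ∞ η) (hηc : HasCompactSupport η) (hη0 : ∀ y, 0 ≤ η y)
    {t : ℝ} (ht : t ∈ S) :
    ∫ y, η y * derivWithin (fun s ↦ g.gradSq (φ s) y * Real.exp (-φ s y) * Real.exp (-V y)) S t
        ∂g.riemVolume ≤
      -2 * K * ∫ y, η y * (g.gradSq (φ t) y * Real.exp (-φ t y) * Real.exp (-V y)) ∂g.riemVolume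
      + ∫ y, g.gradSq (φ t) y * Real.exp (-φ t y) * (g.dalembertian η y
          - g.innerDual y (mvfderiv (𝓡 n) V y).toLinearMap (mvfderiv (𝓡 n) η y).toLinearMap)
          * Real.exp (-V y) ∂g.riemVolume := by
  have hF : ContMDiff (𝓡 n) 𝓘(ℝ, ℝ) ∞ (φ t) :=
    hφ.comp_contMDiff (contMDiff_id.prodMk contMDiff_const) fun y ↦ ⟨mem_univ _, ht⟩
  have hF1 : ContMDiff (𝓡 n) 𝓘(ℝ, ℝ) 1 (φ t) := hF.of_le (by norm_num)
  have hF2 : ContMDiff (𝓡 n) 𝓘(ℝ, ℝ) 2 (φ t) := hF.of_le (WithTop.coe_le_coe.mpr le_top)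
  have hQ : ContMDiff (𝓡 n) 𝓘(ℝ, ℝ) ∞ (g.gradSq (φ t)) := contMDiff_gradSq g hF
  have hQ1 : ContMDiff (𝓡 n) 𝓘(ℝ, ℝ) 1 (g.gradSq (φ t)) := hQ.of_le (by norm_num)
  have hQ2 : ContMDiff (𝓡 n) 𝓘(ℝ, ℝ) 2 (g.gradSq (φ t)) := hQ.of_le (WithTop.coe_le_coe.mpr le_top)
  have hV1 : ContMDiff (𝓡 n) 𝓘(ℝ, ℝ) 1 V := hV.of_le (by norm_num)
  have hU : ContMDiff (𝓡 n) 𝓘(ℝ, ℝ) ∞ (fun y ↦ Real.exp (-φ t y)) :=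
    (Real.contDiff_exp.comp contDiff_neg).comp_contMDiff hF
  have hU1 : ContMDiff (𝓡 n) 𝓘(ℝ, ℝ) 1 (fun y ↦ Real.exp (-φ t y)) := hU.of_le (by norm_num)
  have hη1 : ContMDiff (𝓡 n) 𝓘(ℝ, ℝ) 1 η := hη.of_le (by norm_num)
  have hη2 : ContMDiff (𝓡 n) 𝓘(ℝ, ℝ) 2 η := hη.of_le (WithTop.coe_le_coe.mpr le_top)
  have hfd : ∀ y, HasDerivWithinAt (fun s ↦ φ s y) (derivWithin (fun s ↦ φ s y) S t) S t := fun y ↦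
    hasDerivWithinAt_time_of_contMDiffOn (by simp) hφ y ht
  have hqfam := contMDiffOn_gradSq_family g hS hφ
  have hqd : ∀ y, HasDerivWithinAt (fun s ↦ g.gradSq (φ s) y)
      (derivWithin (fun s ↦ g.gradSq (φ s) y) S t) S t := fun y ↦
    hasDerivWithinAt_time_of_contMDiffOn (by simp) hqfam y ht
  have hprod : ∀ y, derivWithin (fun s ↦ g.gradSq (φ s) y * Real.exp (-φ s y) * Real.exp (-V y)) S t =
      (derivWithin (fun s ↦ g.gradSq (φ s) y) S t * Real.exp (-φ t y)
        + g.gradSq (φ t) y * (Real.exp (-φ t y) * -(derivWithin (fun s ↦ φ s y) S t)))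
        * Real.exp (-V y) := by
    intro y
    have hu : HasDerivWithinAt (fun s ↦ Real.exp (-φ s y))
        (Real.exp (-φ t y) * -(derivWithin (fun s ↦ φ s y) S t)) S t := ((hfd y).neg).exp
    exact (((hqd y).mul hu).mul_const (Real.exp (-V y))).derivWithin (hS t ht)
  have hpt := fisher_pointwise_le g hg hV hRic hS hS' hφ heq
  have hbound : ∀ y, η y * derivWithin (fun s ↦ g.gradSq (φ s) y * Real.exp (-φ s y) * Real.exp (-V y)) S t ≤
      η y * (((g.dalembertian (g.gradSq (φ t)) y
          - g.innerDual y (mvfderiv (𝓡 n) V y).toLinearMap (mvfderiv (𝓡 n) (g.gradSq (φ t)) y).toLinearMap)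
        - 2 * g.innerDual y (mvfderiv (𝓡 n) (φ t) y).toLinearMap (mvfderiv (𝓡 n) (g.gradSq (φ t)) y).toLinearMap
        - 2 * K * g.gradSq (φ t) y
        - g.gradSq (φ t) y * (g.dalembertian (φ t) y
            - g.innerDual y (mvfderiv (𝓡 n) V y).toLinearMap (mvfderiv (𝓡 n) (φ t) y).toLinearMap
            - g.gradSq (φ t) y))
        * Real.exp (-φ t y) * Real.exp (-V y)) := by
    intro y
    refine mul_le_mul_of_nonneg_left ?_ (hη0 y)
    rw [hprod y, heq t ht y]
    have h1 := hpt y ht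
    have hu : 0 ≤ Real.exp (-φ t y) := (Real.exp_pos _).le
    have hw : 0 ≤ Real.exp (-V y) := (Real.exp_pos _).le
    have huw : 0 ≤ Real.exp (-φ t y) * Real.exp (-V y) := mul_nonneg hu hw
    nlinarith [mul_le_mul_of_nonneg_right h1 huw]
  have hΔQc : Continuous (g.dalembertian (g.gradSq (φ t))) := continuous_dalembertian g hQ2
  have hΔFc : Continuous (g.dalembertian (φ t)) := continuous_dalembertian g hF2
  have hΔηc : Continuous (g.dalembertian η) := continuous_dalembertian g hη2
  have hIVQ : Continuous fun y ↦ g.innerDual y (mvfderiv (𝓡 n) V y).toLinearMap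
      (mvfderiv (𝓡 n) (g.gradSq (φ t)) y).toLinearMap := continuous_innerDual_mvfderiv g hV1 hQ1
  have hIFQ : Continuous fun y ↦ g.innerDual y (mvfderiv (𝓡 n) (φ t) y).toLinearMap
      (mvfderiv (𝓡 n) (g.gradSq (φ t)) y).toLinearMap := continuous_innerDual_mvfderiv g hF1 hQ1
  have hIVF : Continuous fun y ↦ g.innerDual y (mvfderiv (𝓡 n) V y).toLinearMap
      (mvfderiv (𝓡 n) (φ t) y).toLinearMap := continuous_innerDual_mvfderiv g hV1 hF1
  have hIVη : Continuous fun y ↦ g.innerDual y (mvfderiv (𝓡 n) V y).toLinearMap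
      (mvfderiv (𝓡 n) η y).toLinearMap := continuous_innerDual_mvfderiv g hV1 hη1
  have hIηQ : Continuous fun y ↦ g.innerDual y (mvfderiv (𝓡 n) η y).toLinearMap
      (mvfderiv (𝓡 n) (g.gradSq (φ t)) y).toLinearMap := continuous_innerDual_mvfderiv g hη1 hQ1
  have hIηF : Continuous fun y ↦ g.innerDual y (mvfderiv (𝓡 n) η y).toLinearMap
      (mvfderiv (𝓡 n) (φ t) y).toLinearMap := continuous_innerDual_mvfderiv g hη1 hF1
  have hQc : Continuous (g.gradSq (φ t)) := hQ.continuous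
  have hUc : Continuous fun y ↦ Real.exp (-φ t y) := hU.continuous
  have hWc : Continuous fun y ↦ Real.exp (-V y) := Real.continuous_exp.comp hV.continuous.neg
  have hηcont : Continuous η := hη.continuous
  have hPfam : ContMDiffOn ((𝓡 n).prod 𝓘(ℝ, ℝ)) 𝓘(ℝ, ℝ) ∞
      (fun p : M × ℝ ↦ g.gradSq (φ p.2) p.1 * Real.exp (-φ p.2 p.1) * Real.exp (-V p.1)) (univ ×ˢ S) := by
    have hu : ContMDiffOn ((𝓡 n).prod 𝓘(ℝ, ℝ)) 𝓘(ℝ, ℝ) ∞ (fun p : M × ℝ ↦ Real.exp (-φ p.2 p.1))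
        (univ ×ˢ S) := (Real.contDiff_exp.comp contDiff_neg).contMDiff.comp_contMDiffOn hφ
    have hw : ContMDiffOn ((𝓡 n).prod 𝓘(ℝ, ℝ)) 𝓘(ℝ, ℝ) ∞ (fun p : M × ℝ ↦ Real.exp (-V p.1)) (univ ×ˢ S) :=
      ((Real.contDiff_exp.comp contDiff_neg).comp_contMDiff (hV.comp contMDiff_fst)).contMDiffOn
    exact (hqfam.mul hu).mul hw
  have hP'fam := contMDiffOn_derivWithin_time_of_uniqueDiffOn
    (u := fun s y ↦ g.gradSq (φ s) y * Real.exp (-φ s y) * Real.exp (-V y)) hS hPfam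
  have hP'c : Continuous fun y ↦ derivWithin
      (fun s ↦ g.gradSq (φ s) y * Real.exp (-φ s y) * Real.exp (-V y)) S t := by
    have h := hP'fam.continuousOn
    exact (h.comp_continuous (continuous_id.prodMk continuous_const) fun y ↦ ⟨mem_univ _, ht⟩ :)
  have hKη : IsCompact (tsupport η) := hηc
  have hsupp_mul : ∀ {G : M → ℝ}, HasCompactSupport fun y ↦ η y * G y := fun {G} ↦ hηc.mul_right
  have hdη0 : ∀ {G : M → ℝ}, ∀ y ∉ tsupport η, g.innerDual y (mvfderiv (𝓡 n) η y).toLinearMap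
      (mvfderiv (𝓡 n) G y).toLinearMap = 0 := fun {G} y hy ↦
    innerDual_mvfderiv_eq_zero_of_notMem_tsupport_left hy
  have hLη0 : ∀ y ∉ tsupport η, g.dalembertian η y
      - g.innerDual y (mvfderiv (𝓡 n) V y).toLinearMap (mvfderiv (𝓡 n) η y).toLinearMap = 0 := by
    intro y hy
    rw [g.dalembertian_eq_zero_of_notMem_tsupport hy, innerDual_mvfderiv_eq_zero_of_notMem_tsupport_right hy]
    ring
  have iL : Integrable (fun y ↦ η y * derivWithin
      (fun s ↦ g.gradSq (φ s) y * Real.exp (-φ s y) * Real.exp (-V y)) S t) g.riemVolume :=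
    integrable_of_continuous_of_hasCompactSupport' hg (hηcont.mul hP'c) hsupp_mul
  have hBc : Continuous fun y ↦ η y * (((g.dalembertian (g.gradSq (φ t)) y
          - g.innerDual y (mvfderiv (𝓡 n) V y).toLinearMap (mvfderiv (𝓡 n) (g.gradSq (φ t)) y).toLinearMap)
        - 2 * g.innerDual y (mvfderiv (𝓡 n) (φ t) y).toLinearMap (mvfderiv (𝓡 n) (g.gradSq (φ t)) y).toLinearMap
        - 2 * K * g.gradSq (φ t) y
        - g.gradSq (φ t) y * (g.dalembertian (φ t) y
            - g.innerDual y (mvfderiv (𝓡 n) V y).toLinearMap (mvfderiv (𝓡 n) (φ t) y).toLinearMap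
            - g.gradSq (φ t) y))
        * Real.exp (-φ t y) * Real.exp (-V y)) :=
    hηcont.mul ((((((hΔQc.sub hIVQ).sub (continuous_const.mul hIFQ)).sub (continuous_const.mul hQc)).sub
      (hQc.mul ((hΔFc.sub hIVF).sub hQc))).mul hUc).mul hWc)
  have iB := integrable_of_continuous_of_hasCompactSupport' hg hBc hsupp_mul
  have hmono := integral_mono iL iB fun y ↦ hbound y
  refine hmono.trans (le_of_eq ?_)
  have iA1 : Integrable (fun y ↦ (Real.exp (-φ t y) * η y) * (g.dalembertian (g.gradSq (φ t)) y
      - g.innerDual y (mvfderiv (𝓡 n) V y).toLinearMap (mvfderiv (𝓡 n) (g.gradSq (φ t)) y).toLinearMap)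
      * Real.exp (-V y)) g.riemVolume :=
    integrable_of_continuous_of_hasCompactSupport' hg (((hUc.mul hηcont).mul (hΔQc.sub hIVQ)).mul hWc)
      ((hηc.mul_left).mul_right.mul_right)
  have iA2 : Integrable (fun y ↦ η y * (g.innerDual y (mvfderiv (𝓡 n) (φ t) y).toLinearMap
      (mvfderiv (𝓡 n) (g.gradSq (φ t)) y).toLinearMap * Real.exp (-φ t y) * Real.exp (-V y))) g.riemVolume :=
    integrable_of_continuous_of_hasCompactSupport' hg (hηcont.mul ((hIFQ.mul hUc).mul hWc)) hsupp_mul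
  have iA3 : Integrable (fun y ↦ η y * (g.gradSq (φ t) y * Real.exp (-φ t y) * Real.exp (-V y)))
      g.riemVolume :=
    integrable_of_continuous_of_hasCompactSupport' hg (hηcont.mul ((hQc.mul hUc).mul hWc)) hsupp_mul
  have iA4 : Integrable (fun y ↦ (g.gradSq (φ t) y * Real.exp (-φ t y) * η y) * (g.dalembertian (φ t) y
      - g.innerDual y (mvfderiv (𝓡 n) V y).toLinearMap (mvfderiv (𝓡 n) (φ t) y).toLinearMap)
      * Real.exp (-V y)) g.riemVolume :=
    integrable_of_continuous_of_hasCompactSupport' hg ((((hQc.mul hUc).mul hηcont).mul (hΔFc.sub hIVF)).mul hWc)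
      ((hηc.mul_left).mul_right.mul_right)
  have iA5 : Integrable (fun y ↦ η y * (g.gradSq (φ t) y * g.gradSq (φ t) y * Real.exp (-φ t y)
      * Real.exp (-V y))) g.riemVolume :=
    integrable_of_continuous_of_hasCompactSupport' hg (hηcont.mul (((hQc.mul hQc).mul hUc).mul hWc)) hsupp_mul
  have iB1 : Integrable (fun y ↦ Real.exp (-φ t y) * g.innerDual y (mvfderiv (𝓡 n) η y).toLinearMap
      (mvfderiv (𝓡 n) (g.gradSq (φ t)) y).toLinearMap * Real.exp (-V y)) g.riemVolume := by
    refine integrable_of_continuous_of_hasCompactSupport' hg ((hUc.mul hIηQ).mul hWc) ?_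
    exact ((HasCompactSupport.intro hKη (hdη0 (G := g.gradSq (φ t)))).mul_left).mul_right
  have iB2 : Integrable (fun y ↦ g.gradSq (φ t) y * Real.exp (-φ t y) * g.innerDual y
      (mvfderiv (𝓡 n) η y).toLinearMap (mvfderiv (𝓡 n) (φ t) y).toLinearMap * Real.exp (-V y)) g.riemVolume := by
    refine integrable_of_continuous_of_hasCompactSupport' hg (((hQc.mul hUc).mul hIηF).mul hWc) ?_
    exact ((HasCompactSupport.intro hKη (hdη0 (G := φ t))).mul_left).mul_right
  have iB3 : Integrable (fun y ↦ g.gradSq (φ t) y * Real.exp (-φ t y) * (g.dalembertian η y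
      - g.innerDual y (mvfderiv (𝓡 n) V y).toLinearMap (mvfderiv (𝓡 n) η y).toLinearMap) * Real.exp (-V y))
      g.riemVolume := by
    refine integrable_of_continuous_of_hasCompactSupport' hg (((hQc.mul hUc).mul (hΔηc.sub hIVη)).mul hWc) ?_
    exact ((HasCompactSupport.intro hKη hLη0).mul_left).mul_right
  -- (G1) ∫ (uη)(LQ) w = −∫ ⟨d(uη), dQ⟩ w = A2 − B1
  have hG1 := weightedGreen_left hg (a := fun y ↦ Real.exp (-φ t y) * η y) (b := g.gradSq (φ t)) (V := V)
    (hU1.mul hη1) (hηc.mul_left) hQ2 hV1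
  have hG1' : ∫ y, g.innerDual y (mvfderiv (𝓡 n) (fun y ↦ Real.exp (-φ t y) * η y) y).toLinearMap
      (mvfderiv (𝓡 n) (g.gradSq (φ t)) y).toLinearMap * Real.exp (-V y) ∂g.riemVolume =
      ∫ y, (-(η y * (g.innerDual y (mvfderiv (𝓡 n) (φ t) y).toLinearMap
          (mvfderiv (𝓡 n) (g.gradSq (φ t)) y).toLinearMap * Real.exp (-φ t y) * Real.exp (-V y)))
        + Real.exp (-φ t y) * g.innerDual y (mvfderiv (𝓡 n) η y).toLinearMap
          (mvfderiv (𝓡 n) (g.gradSq (φ t)) y).toLinearMap * Real.exp (-V y)) ∂g.riemVolume := by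
    refine integral_congr_ae (Eventually.of_forall fun y ↦ ?_)
    dsimp only
    rw [innerDual_mvfderiv_mul_left (hU1.mdifferentiableAt one_ne_zero) (hη1.mdifferentiableAt one_ne_zero),
      innerDual_mvfderiv_exp_neg_left (hF1.mdifferentiableAt one_ne_zero)]
    ring
  have hG1'' : ∫ y, (-(η y * (g.innerDual y (mvfderiv (𝓡 n) (φ t) y).toLinearMap
          (mvfderiv (𝓡 n) (g.gradSq (φ t)) y).toLinearMap * Real.exp (-φ t y) * Real.exp (-V y)))
        + Real.exp (-φ t y) * g.innerDual y (mvfderiv (𝓡 n) η y).toLinearMap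
          (mvfderiv (𝓡 n) (g.gradSq (φ t)) y).toLinearMap * Real.exp (-V y)) ∂g.riemVolume =
      -(∫ y, η y * (g.innerDual y (mvfderiv (𝓡 n) (φ t) y).toLinearMap
          (mvfderiv (𝓡 n) (g.gradSq (φ t)) y).toLinearMap * Real.exp (-φ t y) * Real.exp (-V y)) ∂g.riemVolume)
        + ∫ y, Real.exp (-φ t y) * g.innerDual y (mvfderiv (𝓡 n) η y).toLinearMap
          (mvfderiv (𝓡 n) (g.gradSq (φ t)) y).toLinearMap * Real.exp (-V y) ∂g.riemVolume := by
    have iA2n : Integrable (fun y ↦ -(η y * (g.innerDual y (mvfderiv (𝓡 n) (φ t) y).toLinearMap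
        (mvfderiv (𝓡 n) (g.gradSq (φ t)) y).toLinearMap * Real.exp (-φ t y) * Real.exp (-V y))))
        g.riemVolume := iA2.neg
    have e := integral_add iA2n iB1
    rw [integral_neg] at e
    exact e
  -- (G2) ∫ (Quη)(LF) w = −∫ ⟨d(Quη), dF⟩ w = −A2 + A5 − B2
  have hG2 := weightedGreen_left hg (a := fun y ↦ g.gradSq (φ t) y * Real.exp (-φ t y) * η y) (b := φ t)
    (V := V) ((hQ1.mul hU1).mul hη1) (hηc.mul_left) hF2 hV1
  have hgradF : ∀ y, g.innerDual y (mvfderiv (𝓡 n) (φ t) y).toLinearMap (mvfderiv (𝓡 n) (φ t) y).toLinearMap =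
      g.gradSq (φ t) y := fun y ↦ rfl
  have hG2' : ∫ y, g.innerDual y (mvfderiv (𝓡 n) (fun y ↦ g.gradSq (φ t) y * Real.exp (-φ t y) * η y) y).toLinearMap
      (mvfderiv (𝓡 n) (φ t) y).toLinearMap * Real.exp (-V y) ∂g.riemVolume =
      ∫ y, ((η y * (g.innerDual y (mvfderiv (𝓡 n) (φ t) y).toLinearMap
          (mvfderiv (𝓡 n) (g.gradSq (φ t)) y).toLinearMap * Real.exp (-φ t y) * Real.exp (-V y))
        - η y * (g.gradSq (φ t) y * g.gradSq (φ t) y * Real.exp (-φ t y) * Real.exp (-V y)))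
        + g.gradSq (φ t) y * Real.exp (-φ t y) * g.innerDual y
          (mvfderiv (𝓡 n) η y).toLinearMap (mvfderiv (𝓡 n) (φ t) y).toLinearMap * Real.exp (-V y))
        ∂g.riemVolume := by
    refine integral_congr_ae (Eventually.of_forall fun y ↦ ?_)
    dsimp only
    have hQU : MDifferentiableAt (𝓡 n) 𝓘(ℝ, ℝ) (fun y ↦ g.gradSq (φ t) y * Real.exp (-φ t y)) y :=
      (hQ1.mul hU1).mdifferentiableAt one_ne_zero
    rw [innerDual_mvfderiv_mul_left hQU (hη1.mdifferentiableAt one_ne_zero),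
      innerDual_mvfderiv_mul_left (hQ1.mdifferentiableAt one_ne_zero) (hU1.mdifferentiableAt one_ne_zero),
      innerDual_mvfderiv_exp_neg_left (hF1.mdifferentiableAt one_ne_zero), hgradF y,
      g.innerDual_comm y (mvfderiv (𝓡 n) (g.gradSq (φ t)) y).toLinearMap]
    ring
  have hG2'' : ∫ y, ((η y * (g.innerDual y (mvfderiv (𝓡 n) (φ t) y).toLinearMap
          (mvfderiv (𝓡 n) (g.gradSq (φ t)) y).toLinearMap * Real.exp (-φ t y) * Real.exp (-V y))
        - η y * (g.gradSq (φ t) y * g.gradSq (φ t) y * Real.exp (-φ t y) * Real.exp (-V y)))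
        + g.gradSq (φ t) y * Real.exp (-φ t y) * g.innerDual y
          (mvfderiv (𝓡 n) η y).toLinearMap (mvfderiv (𝓡 n) (φ t) y).toLinearMap * Real.exp (-V y))
        ∂g.riemVolume =
      ((∫ y, η y * (g.innerDual y (mvfderiv (𝓡 n) (φ t) y).toLinearMap
          (mvfderiv (𝓡 n) (g.gradSq (φ t)) y).toLinearMap * Real.exp (-φ t y) * Real.exp (-V y)) ∂g.riemVolume)
        - ∫ y, η y * (g.gradSq (φ t) y * g.gradSq (φ t) y * Real.exp (-φ t y) * Real.exp (-V y)) ∂g.riemVolume)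
        + ∫ y, g.gradSq (φ t) y * Real.exp (-φ t y) * g.innerDual y
          (mvfderiv (𝓡 n) η y).toLinearMap (mvfderiv (𝓡 n) (φ t) y).toLinearMap * Real.exp (-V y)
          ∂g.riemVolume := by
    have iA25 : Integrable (fun y ↦ η y * (g.innerDual y (mvfderiv (𝓡 n) (φ t) y).toLinearMap
          (mvfderiv (𝓡 n) (g.gradSq (φ t)) y).toLinearMap * Real.exp (-φ t y) * Real.exp (-V y))
        - η y * (g.gradSq (φ t) y * g.gradSq (φ t) y * Real.exp (-φ t y) * Real.exp (-V y))) g.riemVolume :=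
      iA2.sub iA5
    have e := integral_add iA25 iB2
    have e' := integral_sub iA2 iA5
    rw [e'] at e
    exact e
  -- (G3) ∫ (Qu)(Lη) w = −∫ ⟨d(Qu), dη⟩ w = −B1 + B2
  have hG3 := weightedGreen_right hg (a := fun y ↦ g.gradSq (φ t) y * Real.exp (-φ t y)) (b := η) (V := V)
    (hQ1.mul hU1) hη2 hηc hV1
  have hG3' : ∫ y, g.innerDual y (mvfderiv (𝓡 n) (fun y ↦ g.gradSq (φ t) y * Real.exp (-φ t y)) y).toLinearMap
      (mvfderiv (𝓡 n) η y).toLinearMap * Real.exp (-V y) ∂g.riemVolume =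
      ∫ y, (Real.exp (-φ t y) * g.innerDual y (mvfderiv (𝓡 n) η y).toLinearMap
          (mvfderiv (𝓡 n) (g.gradSq (φ t)) y).toLinearMap * Real.exp (-V y)
        - g.gradSq (φ t) y * Real.exp (-φ t y) * g.innerDual y
          (mvfderiv (𝓡 n) η y).toLinearMap (mvfderiv (𝓡 n) (φ t) y).toLinearMap * Real.exp (-V y))
        ∂g.riemVolume := by
    refine integral_congr_ae (Eventually.of_forall fun y ↦ ?_)
    dsimp only
    rw [innerDual_mvfderiv_mul_left (hQ1.mdifferentiableAt one_ne_zero) (hU1.mdifferentiableAt one_ne_zero),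
      innerDual_mvfderiv_exp_neg_left (hF1.mdifferentiableAt one_ne_zero),
      g.innerDual_comm y (mvfderiv (𝓡 n) (g.gradSq (φ t)) y).toLinearMap,
      g.innerDual_comm y (mvfderiv (𝓡 n) (φ t) y).toLinearMap]
    ring
  have hG3'' : ∫ y, (Real.exp (-φ t y) * g.innerDual y (mvfderiv (𝓡 n) η y).toLinearMap
          (mvfderiv (𝓡 n) (g.gradSq (φ t)) y).toLinearMap * Real.exp (-V y)
        - g.gradSq (φ t) y * Real.exp (-φ t y) * g.innerDual y
          (mvfderiv (𝓡 n) η y).toLinearMap (mvfderiv (𝓡 n) (φ t) y).toLinearMap * Real.exp (-V y))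
        ∂g.riemVolume =
      (∫ y, Real.exp (-φ t y) * g.innerDual y (mvfderiv (𝓡 n) η y).toLinearMap
          (mvfderiv (𝓡 n) (g.gradSq (φ t)) y).toLinearMap * Real.exp (-V y) ∂g.riemVolume)
        - ∫ y, g.gradSq (φ t) y * Real.exp (-φ t y) * g.innerDual y
          (mvfderiv (𝓡 n) η y).toLinearMap (mvfderiv (𝓡 n) (φ t) y).toLinearMap * Real.exp (-V y)
          ∂g.riemVolume := integral_sub iB1 iB2
  have s1 : ∫ y, η y * (((g.dalembertian (g.gradSq (φ t)) y
          - g.innerDual y (mvfderiv (𝓡 n) V y).toLinearMap (mvfderiv (𝓡 n) (g.gradSq (φ t)) y).toLinearMap)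
        - 2 * g.innerDual y (mvfderiv (𝓡 n) (φ t) y).toLinearMap (mvfderiv (𝓡 n) (g.gradSq (φ t)) y).toLinearMap
        - 2 * K * g.gradSq (φ t) y
        - g.gradSq (φ t) y * (g.dalembertian (φ t) y
            - g.innerDual y (mvfderiv (𝓡 n) V y).toLinearMap (mvfderiv (𝓡 n) (φ t) y).toLinearMap
            - g.gradSq (φ t) y))
        * Real.exp (-φ t y) * Real.exp (-V y)) ∂g.riemVolume =
      ∫ y, (((((Real.exp (-φ t y) * η y) * (g.dalembertian (g.gradSq (φ t)) y
          - g.innerDual y (mvfderiv (𝓡 n) V y).toLinearMap (mvfderiv (𝓡 n) (g.gradSq (φ t)) y).toLinearMap)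
          * Real.exp (-V y)
        - 2 * (η y * (g.innerDual y (mvfderiv (𝓡 n) (φ t) y).toLinearMap
          (mvfderiv (𝓡 n) (g.gradSq (φ t)) y).toLinearMap * Real.exp (-φ t y) * Real.exp (-V y))))
        - 2 * K * (η y * (g.gradSq (φ t) y * Real.exp (-φ t y) * Real.exp (-V y))))
        - (g.gradSq (φ t) y * Real.exp (-φ t y) * η y) * (g.dalembertian (φ t) y
          - g.innerDual y (mvfderiv (𝓡 n) V y).toLinearMap (mvfderiv (𝓡 n) (φ t) y).toLinearMap)
          * Real.exp (-V y))
        + η y * (g.gradSq (φ t) y * g.gradSq (φ t) y * Real.exp (-φ t y) * Real.exp (-V y)))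
        ∂g.riemVolume :=
    integral_congr_ae (Eventually.of_forall fun y ↦ by ring)
  have e1 : ∫ y, (((Real.exp (-φ t y) * η y) * (g.dalembertian (g.gradSq (φ t)) y
          - g.innerDual y (mvfderiv (𝓡 n) V y).toLinearMap (mvfderiv (𝓡 n) (g.gradSq (φ t)) y).toLinearMap)
          * Real.exp (-V y)) - (2 * (η y * (g.innerDual y (mvfderiv (𝓡 n) (φ t) y).toLinearMap
          (mvfderiv (𝓡 n) (g.gradSq (φ t)) y).toLinearMap * Real.exp (-φ t y) * Real.exp (-V y)))) - (2 * K * (η y * (g.gradSq (φ t) y * Real.exp (-φ t y) * Real.exp (-V y)))) - ((g.gradSq (φ t) y * Real.exp (-φ t y) * η y) * (g.dalembertian (φ t) y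
          - g.innerDual y (mvfderiv (𝓡 n) V y).toLinearMap (mvfderiv (𝓡 n) (φ t) y).toLinearMap)
          * Real.exp (-V y)) + (η y * (g.gradSq (φ t) y * g.gradSq (φ t) y * Real.exp (-φ t y) * Real.exp (-V y)))) ∂g.riemVolume =
      (∫ y, (((Real.exp (-φ t y) * η y) * (g.dalembertian (g.gradSq (φ t)) y
          - g.innerDual y (mvfderiv (𝓡 n) V y).toLinearMap (mvfderiv (𝓡 n) (g.gradSq (φ t)) y).toLinearMap)
          * Real.exp (-V y)) - (2 * (η y * (g.innerDual y (mvfderiv (𝓡 n) (φ t) y).toLinearMap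
          (mvfderiv (𝓡 n) (g.gradSq (φ t)) y).toLinearMap * Real.exp (-φ t y) * Real.exp (-V y)))) - (2 * K * (η y * (g.gradSq (φ t) y * Real.exp (-φ t y) * Real.exp (-V y)))) - ((g.gradSq (φ t) y * Real.exp (-φ t y) * η y) * (g.dalembertian (φ t) y
          - g.innerDual y (mvfderiv (𝓡 n) V y).toLinearMap (mvfderiv (𝓡 n) (φ t) y).toLinearMap)
          * Real.exp (-V y))) ∂g.riemVolume)
      + ∫ y, (η y * (g.gradSq (φ t) y * g.gradSq (φ t) y * Real.exp (-φ t y) * Real.exp (-V y))) ∂g.riemVolume :=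
    integral_add (((iA1.sub (iA2.const_mul 2)).sub (iA3.const_mul (2 * K))).sub iA4) iA5
  have e2 : ∫ y, (((Real.exp (-φ t y) * η y) * (g.dalembertian (g.gradSq (φ t)) y
          - g.innerDual y (mvfderiv (𝓡 n) V y).toLinearMap (mvfderiv (𝓡 n) (g.gradSq (φ t)) y).toLinearMap)
          * Real.exp (-V y)) - (2 * (η y * (g.innerDual y (mvfderiv (𝓡 n) (φ t) y).toLinearMap
          (mvfderiv (𝓡 n) (g.gradSq (φ t)) y).toLinearMap * Real.exp (-φ t y) * Real.exp (-V y)))) - (2 * K * (η y * (g.gradSq (φ t) y * Real.exp (-φ t y) * Real.exp (-V y)))) - ((g.gradSq (φ t) y * Real.exp (-φ t y) * η y) * (g.dalembertian (φ t) y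
          - g.innerDual y (mvfderiv (𝓡 n) V y).toLinearMap (mvfderiv (𝓡 n) (φ t) y).toLinearMap)
          * Real.exp (-V y))) ∂g.riemVolume =
      (∫ y, (((Real.exp (-φ t y) * η y) * (g.dalembertian (g.gradSq (φ t)) y
          - g.innerDual y (mvfderiv (𝓡 n) V y).toLinearMap (mvfderiv (𝓡 n) (g.gradSq (φ t)) y).toLinearMap)
          * Real.exp (-V y)) - (2 * (η y * (g.innerDual y (mvfderiv (𝓡 n) (φ t) y).toLinearMap
          (mvfderiv (𝓡 n) (g.gradSq (φ t)) y).toLinearMap * Real.exp (-φ t y) * Real.exp (-V y)))) - (2 * K * (η y * (g.gradSq (φ t) y * Real.exp (-φ t y) * Real.exp (-V y))))) ∂g.riemVolume)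
      - ∫ y, ((g.gradSq (φ t) y * Real.exp (-φ t y) * η y) * (g.dalembertian (φ t) y
          - g.innerDual y (mvfderiv (𝓡 n) V y).toLinearMap (mvfderiv (𝓡 n) (φ t) y).toLinearMap)
          * Real.exp (-V y)) ∂g.riemVolume :=
    integral_sub ((iA1.sub (iA2.const_mul 2)).sub (iA3.const_mul (2 * K))) iA4
  have e3 : ∫ y, (((Real.exp (-φ t y) * η y) * (g.dalembertian (g.gradSq (φ t)) y
          - g.innerDual y (mvfderiv (𝓡 n) V y).toLinearMap (mvfderiv (𝓡 n) (g.gradSq (φ t)) y).toLinearMap)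
          * Real.exp (-V y)) - (2 * (η y * (g.innerDual y (mvfderiv (𝓡 n) (φ t) y).toLinearMap
          (mvfderiv (𝓡 n) (g.gradSq (φ t)) y).toLinearMap * Real.exp (-φ t y) * Real.exp (-V y)))) - (2 * K * (η y * (g.gradSq (φ t) y * Real.exp (-φ t y) * Real.exp (-V y))))) ∂g.riemVolume =
      (∫ y, (((Real.exp (-φ t y) * η y) * (g.dalembertian (g.gradSq (φ t)) y
          - g.innerDual y (mvfderiv (𝓡 n) V y).toLinearMap (mvfderiv (𝓡 n) (g.gradSq (φ t)) y).toLinearMap)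
          * Real.exp (-V y)) - (2 * (η y * (g.innerDual y (mvfderiv (𝓡 n) (φ t) y).toLinearMap
          (mvfderiv (𝓡 n) (g.gradSq (φ t)) y).toLinearMap * Real.exp (-φ t y) * Real.exp (-V y))))) ∂g.riemVolume)
      - ∫ y, (2 * K * (η y * (g.gradSq (φ t) y * Real.exp (-φ t y) * Real.exp (-V y)))) ∂g.riemVolume :=
    integral_sub (iA1.sub (iA2.const_mul 2)) (iA3.const_mul (2 * K))
  have e4 : ∫ y, (((Real.exp (-φ t y) * η y) * (g.dalembertian (g.gradSq (φ t)) y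
          - g.innerDual y (mvfderiv (𝓡 n) V y).toLinearMap (mvfderiv (𝓡 n) (g.gradSq (φ t)) y).toLinearMap)
          * Real.exp (-V y)) - (2 * (η y * (g.innerDual y (mvfderiv (𝓡 n) (φ t) y).toLinearMap
          (mvfderiv (𝓡 n) (g.gradSq (φ t)) y).toLinearMap * Real.exp (-φ t y) * Real.exp (-V y))))) ∂g.riemVolume =
      (∫ y, ((Real.exp (-φ t y) * η y) * (g.dalembertian (g.gradSq (φ t)) y
          - g.innerDual y (mvfderiv (𝓡 n) V y).toLinearMap (mvfderiv (𝓡 n) (g.gradSq (φ t)) y).toLinearMap)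
          * Real.exp (-V y)) ∂g.riemVolume)
      - ∫ y, (2 * (η y * (g.innerDual y (mvfderiv (𝓡 n) (φ t) y).toLinearMap
          (mvfderiv (𝓡 n) (g.gradSq (φ t)) y).toLinearMap * Real.exp (-φ t y) * Real.exp (-V y)))) ∂g.riemVolume :=
    integral_sub iA1 (iA2.const_mul 2)
  have e5 : ∫ y, (2 * (η y * (g.innerDual y (mvfderiv (𝓡 n) (φ t) y).toLinearMap
          (mvfderiv (𝓡 n) (g.gradSq (φ t)) y).toLinearMap * Real.exp (-φ t y) * Real.exp (-V y)))) ∂g.riemVolume =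
      2 * ∫ y, (η y * (g.innerDual y (mvfderiv (𝓡 n) (φ t) y).toLinearMap (mvfderiv (𝓡 n) (g.gradSq (φ t)) y).toLinearMap * Real.exp (-φ t y) * Real.exp (-V y))) ∂g.riemVolume :=
    integral_const_mul 2 _
  have e6 : ∫ y, (2 * K * (η y * (g.gradSq (φ t) y * Real.exp (-φ t y) * Real.exp (-V y)))) ∂g.riemVolume =
      2 * K * ∫ y, (η y * (g.gradSq (φ t) y * Real.exp (-φ t y) * Real.exp (-V y))) ∂g.riemVolume :=
    integral_const_mul (2 * K) _
  rw [s1]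
  linarith [e1, e2, e3, e4, e5, e6, hG1, hG1', hG1'', hG2, hG2', hG2'', hG3, hG3', hG3'']

end Fisher

/-- Registered helper `helper_fisherCutoff`: the dissipation of the cut-off Fisher information at a fixed time on a
(non-compact) Riemannian manifold modelled on `ℝⁿ` with `Ric + Hess V ≥ K g` (`fisherCutoff_le`).
[cite: CarrilloNi2009, §3 (p. 8)] -/
theorem helper_fisherCutoff : ∀ (n : ℕ) (M : Type*) [TopologicalSpace M] [T2Space M] [SecondCountableTopology M] [ChartedSpace (EuclideanSpace ℝ (Fin n)) M] [IsManifold (𝓡 n) ∞ M] [T3Space M] [MeasurableSpace M] [BorelSpace M] (g : PseudoRiemannianMetric (𝓡 n) ∞ (EuclideanSpace ℝ (Fin n)) (TangentSpace (𝓡 n) : M → Type _)) [g.HasLeviCivita] (V : M → ℝ) (K : ℝ), g.IsRiemannian → ContMDiff (𝓡 n) 𝓘(ℝ, ℝ) ∞ V → (∀ (y : M) (X : TangentSpace (𝓡 n) y), K * g.val y X X ≤ g.ricci y X X + g.hessian V y X X) → ∀ (φ : ℝ → M → ℝ) (S : Set ℝ), UniqueDiffOn ℝ S → S ⊆ closure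 (interior S) → ContMDiffOn ((𝓡 n).prod 𝓘(ℝ, ℝ)) 𝓘(ℝ, ℝ) ∞ (fun p : M × ℝ ↦ φ p.2 p.1) (univ ×ˢ S) → (∀ t ∈ S, ∀ y : M, derivWithin (fun s ↦ φ s y) S t = g.dalembertian (φ t) y - g.innerDual y (mvfderiv (𝓡 n) V y).toLinearMap (mvfderiv (𝓡 n) (φ t) y).toLinearMap - g.gradSq (φ t) y) → ∀ (η : M → ℝ), ContMDiff (𝓡 n) 𝓘(ℝ, ℝ) ∞ η → HasCompactSupport η → (∀ y, 0 ≤ η y) → ∀ t ∈ S, ∫ y, η y * derivWithin (fun s ↦ g.gradSq (φ s) y * Real.exp (-φ s y) * Real.exp (-V y)) S t ∂g.riemVolume ≤ -2 * K * ∫ y, η y * (g.gradSq (φ t) y * Real.exp (-φ t y) * Real.exp (-V y)) ∂g.riemVolume + ∫ y, g.gradSq (φ t) y * Real.exp (-φ t y) * (g.dalembertian η y - g.innerDual y (mvfderiv (𝓡 n) V y).toLinearMap (mvfderiv (𝓡 n) η y).toLinearMap) * Real.exp (-V y) ∂g.riemVolume := by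
  intro n M _ _ _ _ _ _ _ _ g _ V K hg hV hRic φ S hS hS' hφ heq η hη hηc hη0 t ht
  exact fisherCutoff_le hg hV hRic hS hS' hφ heq hη hηc hη0 ht


end Summit.SmoothPoincare4.SmoothPoincare4.Theorems.NoncompactShrinkerGapHeat

end
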